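import Summits.QuantumFields.BalabanUV.T4Continuum.Support.SkeletonFillFullRoot
import Summits.QuantumFields.BalabanUV.T4Continuum.Support.SkeletonFillFullSmall

/-!
# T⁴ programme, node NE3 — kinematic refinement lemma, leaf R1c∕R1d (row NE3-S4d): **ROOT-CLOSENESS OF THE FINE
# PLAQUETTES OF THE CLOSED-FORM FILLING**, case III — the far face in the higher direction (file F4c `SkeletonFillFullRootFar`)

Cell `pub-balaban`, NE3 formalisation swarm `b2b-balaban-t4-ne3-formalise-*`, unit `b2b-balaban-t4-ne3-formalise-leaf-04`
(LEAF PROVER 04, gen 2), written for row **S4d** of `t4/formal/NE3/LEAVES.md` BY ARRANGEMENT with its holder leaf-07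
(journal OFFER «F3-GRAD SPLIT» ∕ «F3-GRAD PLAN v1», 2026-08-20T08:12Z ∕ 08:19Z); continuation of `SkeletonFillFullRoot` (F4b,
cases I–II).  Hypothesis `hroot` of `SkeletonFillFullGradReduce.covGrad_fullFill_le_of_rootClose` (F4a), case III: the
plaquette with corner `L•z + q`, `q_ν = L − 1 > q_μ` (`μ < ν`), is within
`ρ_III = 2θ(θ+θ_L) + 2La₀(θ+θ_L) + d(L−1)δ + 2(2θ+3θ_L)a₀` of its cell's root `h(z;μ,ν)` (`θ = d(L−1)a₀`, `θ_L = d(L−1)La₀`,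
`δ` the covariant root gradient across the coarse bond `(z,ν)`).  The word is leaf-07's `SkeletonFillFull.hol_plaq_fullFill_farν`
(F2) BY NAME; the chain is leaf-07's `SkeletonFillFullFaces.norm_plaq_farν_sub_one_le` (F3b) with the target moved from
`BΛ·Ã` to `g·BΛ·Ã`: after the two commutator moves and the transport of the neighbour's rows the two sides read
`Fr·(Λ_b A₁ g A₂)` and `Fr·g·(Λ_b A₁ A₂)`, `Fr = B·Λ_a·g^{kL}` — one more commutator of the single root `g` with `Λ_b A₁`
and one with `Fr`; the abelian tally `g^L·(g^{L−1})⁻¹ = g` is the anchor.  NO term linear in `a₀`.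

CONTENT (all [folklore]; `Matrix n n ℂ`; 0 sorry): `norm_val_plaq4_sub_eq` (root-anchored plaquette frame, for F4d),
**`norm_plaq_farν_sub_root_le`** (leaf-07's arithmetic helper `SkeletonFillFullSmall.two_mul_mul_le` BY NAME).

HONEST FRAMING.  Norm bookkeeping for a kinematic construction; no minimiser, no conditional of the cell (`BetaPertH`, (B),
G-an2-4); nothing bears on infinite volume, a mass gap, or the Clay problem; **NE3 is NOT proved**; `SmoothRefine` ∕
`ApproxRefine` NOT proved.  Finite T⁴ rung (B)+1.  ABSOLUTE RULE kept: no printed sentence is a hypothesis; no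
`def … : Prop` fact; no `sorry`; axioms ⊆ {propext, Classical.choice, Quot.sound}.  PLACEMENT (human rule 2026-08-19):
under `Summits/QuantumFields/BalabanUV/`; imports F4b + leaf-07's F3c (for `two_mul_mul_le`); restates nothing.
HONEST DEPENDENCY: continuum YM on T⁴ ⇐ BetaPertH ∧ nine spine estimates (0/9 proved); BetaPertH ⇐ (D1) ∧ (D4) ∧ CAP+tail;
G-an2-4 gates asym, D1 and NE2/3/4.
-/

set_option autoImplicit false

open scoped BigOperators Matrix Matrix.Norms.L2Operator
open NormedSpace

namespace Summit.QuantumFields.BalabanUV.T4Continuum.SkeletonFillFullRootFar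

open Literature.MathematicalPhysics.QuantumFieldTheory.Balaban1983to89
open B7Prop1Explicit B7Prop2Explicit B7Prop1Local MatrixLog UnitaryModel
open T4AveragingDeficitWall hiding Site Plane Plaq Bond
open AveragingDeficitTransport AveragingDeficitNearIdentity GaugeFieldPerturbation
open SkeletonLattice SkeletonFill SkeletonFillFull SkeletonFillFullNorms SkeletonFillFullFaces SkeletonFillFullRoot
open SkeletonFillFullSmall (two_mul_mul_le)

noncomputable section

variable {d : ℕ} {n : Type*} [Fintype n] [DecidableEq n]

section Frame4

/-- **THE PLAQUETTE FRAME AGAINST A ROOT**: `‖A M A′⁻¹ N⁻¹ − g‖ = ‖A M − g·(N A′)‖` for unitary `A′, N` (the root-anchored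
twin of leaf-07's `SkeletonFillFullNorms.norm_val_plaq4_sub_one`; used by case IV, file F4d). [folklore] -/
theorem norm_val_plaq4_sub_eq {A M A' N g : (Matrix n n ℂ)ˣ} (hA' : A' ∈ unitaryUnits (Matrix n n ℂ))
    (hN : N ∈ unitaryUnits (Matrix n n ℂ)) :
    ‖((A * M * A'⁻¹ * N⁻¹ : (Matrix n n ℂ)ˣ) : Matrix n n ℂ) - (g : Matrix n n ℂ)‖
      = ‖((A * M : (Matrix n n ℂ)ˣ) : Matrix n n ℂ) - ((g * (N * A') : (Matrix n n ℂ)ˣ) : Matrix n n ℂ)‖ := by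
  have e1 : (A * M * A'⁻¹ * N⁻¹ : (Matrix n n ℂ)ˣ) = (A * M) * (N * A')⁻¹ := by group
  have e2 : (g : (Matrix n n ℂ)ˣ) = (g * (N * A')) * (N * A')⁻¹ := by group
  conv_lhs => rw [e1, e2]
  exact norm_val_mul_right_sub ((unitaryUnits (Matrix n n ℂ)).inv_mem ((unitaryUnits (Matrix n n ℂ)).mul_mem hN hA')) _ _

end Frame4

section CaseIII

variable [Nonempty n] {L : ℕ} {a₀ δ : ℝ}



/-- **CASE III (FAR FACE IN `ν`) AGAINST ITS ROOT** (`q_ν = L − 1 > q_μ`…): `‖W(∂p) − h(z;μ,ν)‖ ≤ 2θ(θ+θ_L) +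
2La₀(θ+θ_L) + d(L−1)δ + 2(2θ + 3θ_L)a₀` — leaf-07's F3b chain with the target moved from `BΛ·Ã` to `g·BΛ·Ã`: after the two
commutator moves and the transport of the neighbour's rows the word reads `C·g·A₂` against `g·C·A₂`, `C = B·Λ_a·g^{kL}·Λ_b·A₁`.
[folklore] -/
theorem norm_plaq_farν_sub_root_le (hL : 1 ≤ L) {T : Site d → Fin d → (Matrix n n ℂ)ˣ}
    {h : Site d → Fin d → Fin d → (Matrix n n ℂ)ˣ}
    (hT : ∀ (z : Site d) (κ : Fin d), T z κ ∈ unitaryUnits (Matrix n n ℂ))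
    (hh : ∀ (z : Site d) (κ ν : Fin d), h z κ ν ∈ unitaryUnits (Matrix n n ℂ))
    (ha : ∀ (z : Site d) (κ ν : Fin d), κ < ν → ‖((h z κ ν : (Matrix n n ℂ)ˣ) : Matrix n n ℂ) - 1‖ ≤ a₀) (ha0 : 0 ≤ a₀)
    {z : Site d} {ν : Fin d}
    (hδ : ∀ κ ι : Fin d, κ < ι →
      ‖((T z ν * h (z + e ν) κ ι * (T z ν)⁻¹ : (Matrix n n ℂ)ˣ) : Matrix n n ℂ) - ((h z κ ι : (Matrix n n ℂ)ˣ) : Matrix n n ℂ)‖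
        ≤ δ) (hδ0 : 0 ≤ δ)
    {q : Site d} (hq : InBox L q) {μ : Fin d} (hμν : μ < ν) (hμ : q μ < (L : ℤ) - 1) (hν : q ν = (L : ℤ) - 1) :
    ‖((hol (fullFill L T h) ((L : ℤ) • z + q) (plaqWord μ ν) : (Matrix n n ℂ)ˣ) : Matrix n n ℂ)
        - ((h z μ ν : (Matrix n n ℂ)ˣ) : Matrix n n ℂ)‖
      ≤ 2 * (d * ((L - 1 : ℕ) * a₀)) * (d * ((L - 1 : ℕ) * a₀) + d * (((L - 1 : ℕ) * L) * a₀))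
        + 2 * (L * a₀) * (d * (((L - 1 : ℕ) * L) * a₀) + d * ((L - 1 : ℕ) * a₀))
        + d * ((L - 1 : ℕ) * δ)
        + 2 * (2 * (d * ((L - 1 : ℕ) * a₀)) + 3 * (d * (((L - 1 : ℕ) * L) * a₀))) * a₀ := by
  -- unitarity bookkeeping (as in F3b)
  have hF : ∀ (z' q' : Site d) (κ i : Fin d), ((h z' κ i) ^ (q' i).toNat)⁻¹ ∈ unitaryUnits (Matrix n n ℂ) := fun _ _ _ _ =>
    (unitaryUnits (Matrix n n ℂ)).inv_mem ((unitaryUnits (Matrix n n ℂ)).pow_mem (hh _ _ _) _)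
  have hGm : ∀ (z' q' : Site d) (i κ : Fin d), (h z' i κ) ^ ((q' i).toNat * L) ∈ unitaryUnits (Matrix n n ℂ) := fun _ _ _ _ =>
    (unitaryUnits (Matrix n n ℂ)).pow_mem (hh _ _ _) _
  have huA : ∀ (z' q' : Site d) (κ : Fin d), hiProd h z' q' κ ∈ unitaryUnits (Matrix n n ℂ) := fun _ _ _ =>
    prodOver_mem fun i _ => hF _ _ _ _
  have huL : ∀ (z' q' : Site d) (κ : Fin d), loProd L h z' q' κ ∈ unitaryUnits (Matrix n n ℂ) := fun _ _ _ =>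
    prodOver_mem fun i _ => hGm _ _ _ _
  -- names
  set A := hiProd h z q μ with hAdef
  set B := hiProd h z q ν with hBdef
  set Λ := loProd L h z q ν with hΛdef
  set Λ' := loProd L h z (q + e μ) ν with hΛ'def
  set t := T z ν with htdef
  set As := hiProd h (z + e ν) (q + e ν - (L : ℤ) • e ν) μ with hAsdef
  set g := h z μ ν with hgdef
  have hgu : g ∈ unitaryUnits (Matrix n n ℂ) := hh _ _ _
  -- the word, regrouped as `X · Y⁻¹` with `X = A (BΛ')`, `Y = (BΛ) (t As t⁻¹)`
  have hword : hiProd h z q μ * (hiProd h z q ν * (loProd L h z (q + e μ) ν * T z ν))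
      * (hiProd h (z + e ν) (q + e ν - (L : ℤ) • e ν) μ)⁻¹ * ((loProd L h z q ν * T z ν)⁻¹ * (hiProd h z q ν)⁻¹)
      = A * (B * Λ') * (B * Λ * (t * As * t⁻¹))⁻¹ := by
    simp only [hAdef, hBdef, hΛdef, hΛ'def, htdef, hAsdef]; group
  have huAs : t * As * t⁻¹ ∈ unitaryUnits (Matrix n n ℂ) :=
    (unitaryUnits (Matrix n n ℂ)).mul_mem ((unitaryUnits (Matrix n n ℂ)).mul_mem (hT _ _) (huA _ _ _)) ((unitaryUnits (Matrix n n ℂ)).inv_mem (hT _ _))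
  have huY : B * Λ * (t * As * t⁻¹) ∈ unitaryUnits (Matrix n n ℂ) :=
    (unitaryUnits (Matrix n n ℂ)).mul_mem ((unitaryUnits (Matrix n n ℂ)).mul_mem (huA _ _ _) (huL _ _ _)) huAs
  -- `‖X Y⁻¹ − g‖ = ‖X − g Y‖`
  have hframe : ‖((A * (B * Λ') * (B * Λ * (t * As * t⁻¹))⁻¹ : (Matrix n n ℂ)ˣ) : Matrix n n ℂ) - (g : Matrix n n ℂ)‖
      = ‖((A * (B * Λ') : (Matrix n n ℂ)ˣ) : Matrix n n ℂ) - ((g * (B * Λ * (t * As * t⁻¹)) : (Matrix n n ℂ)ˣ) : Matrix n n ℂ)‖ := by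
    have e1 : (g : (Matrix n n ℂ)ˣ) = g * (B * Λ * (t * As * t⁻¹)) * (B * Λ * (t * As * t⁻¹))⁻¹ := by group
    conv_lhs => rw [e1]
    exact norm_val_mul_right_sub ((unitaryUnits (Matrix n n ℂ)).inv_mem huY) _ _
  rw [hol_plaq_fullFill_farν hL hq hμν hμ hν, hword, hframe]
  -- splits: `A` at `ν`, `Λ`/`Λ'` at `μ` (verbatim from F3b)
  obtain ⟨l₁, l₂, hν₁, hν₂, hl₁₂, hlen, hHsplit⟩ := hiProd_split (G := (Matrix n n ℂ)ˣ) h hμν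
  obtain ⟨m₁, m₂, hμ₁, hμ₂, hm₁₂, hmlen, hLsplit⟩ := loProd_split (G := (Matrix n n ℂ)ˣ) L h hμν
  set F : Fin d → (Matrix n n ℂ)ˣ := fun i => ((h z μ i) ^ (q i).toNat)⁻¹ with hFdef
  set A₁ := prodOver l₁ F with hA₁def
  set A₂ := prodOver l₂ F with hA₂def
  have hA : A = A₁ * (g ^ (q ν).toNat)⁻¹ * A₂ := hHsplit z q
  set F' : Fin d → (Matrix n n ℂ)ˣ := fun i => ((h (z + e ν) μ i) ^ ((q + e ν - (L : ℤ) • e ν) i).toNat)⁻¹ with hF'def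
  have hF'off : ∀ i, i ≠ ν → F' i = ((h (z + e ν) μ i) ^ (q i).toNat)⁻¹ := fun i hi => by
    simp only [hF'def, Pi.add_apply, Pi.sub_apply, Pi.smul_apply, e_apply, if_neg hi, smul_eq_mul, mul_zero,
      add_zero, sub_zero]
  have hmid : ((h (z + e ν) μ ν) ^ ((q + e ν - (L : ℤ) • e ν) ν).toNat)⁻¹ = 1 := by
    simp only [Pi.add_apply, Pi.sub_apply, Pi.smul_apply, e_apply, if_true, smul_eq_mul, mul_one, hν]
    norm_num
  have hAs : As = prodOver l₁ F' * prodOver l₂ F' := by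
    rw [hAsdef, hHsplit (z + e ν) (q + e ν - (L : ℤ) • e ν), hmid, mul_one]
  set At₁ := t * prodOver l₁ F' * t⁻¹ with hAt₁def
  set At₂ := t * prodOver l₂ F' * t⁻¹ with hAt₂def
  have hAt : t * As * t⁻¹ = At₁ * At₂ := by rw [hAs, hAt₁def, hAt₂def]; group
  set Gf : Fin d → (Matrix n n ℂ)ˣ := fun i => (h z i ν) ^ ((q i).toNat * L) with hGfdef
  set Λa := prodOver m₁ Gf with hΛadef
  set Λb := prodOver m₂ Gf with hΛbdef
  have hΛ : Λ = Λa * g ^ ((q μ).toNat * L) * Λb := hLsplit z q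
  have hΛ' : Λ' = Λa * g ^ (((q μ).toNat + 1) * L) * Λb := by
    have h1 := hLsplit z (q + e μ)
    have hagree : ∀ i, i ≠ μ → (h z i ν) ^ (((q + e μ) i).toNat * L) = Gf i := fun i hi => by
      simp only [hGfdef, Pi.add_apply, e_apply, if_neg hi, add_zero]
    rw [prodOver_congr (fun i hi => hagree i (fun he => hμ₁ (he ▸ hi))),
      prodOver_congr (fun i hi => hagree i (fun he => hμ₂ (he ▸ hi))), toNat_add_e_self (hq μ).1] at h1
    exact h1
  -- exponent bookkeeping
  have hm : (q ν).toNat = L - 1 := by have := (hq ν).1; omega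
  have hpow : g ^ (((q μ).toNat + 1) * L) = g ^ ((q μ).toNat * L) * g ^ L := by rw [← pow_add]; ring_nf
  have hgL : g ^ L * (g ^ (q ν).toNat)⁻¹ = g := by
    rw [hm]
    obtain ⟨m, rfl⟩ : ∃ m, L = m + 1 := ⟨L - 1, by omega⟩
    rw [show m + 1 - 1 = m by omega, pow_succ']; group
  -- unitarity of the pieces
  have huF : ∀ i, F i ∈ unitaryUnits (Matrix n n ℂ) := fun i => hF _ _ _ _
  have huF' : ∀ i, F' i ∈ unitaryUnits (Matrix n n ℂ) := fun i => hF _ _ _ _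
  have huGf : ∀ i, Gf i ∈ unitaryUnits (Matrix n n ℂ) := fun i => hGm _ _ _ _
  have huA₁ : A₁ ∈ unitaryUnits (Matrix n n ℂ) := prodOver_mem fun i _ => huF i
  have huA₂ : A₂ ∈ unitaryUnits (Matrix n n ℂ) := prodOver_mem fun i _ => huF i
  have huΛa : Λa ∈ unitaryUnits (Matrix n n ℂ) := prodOver_mem fun i _ => huGf i
  have huΛb : Λb ∈ unitaryUnits (Matrix n n ℂ) := prodOver_mem fun i _ => huGf i
  have huAt₁ : At₁ ∈ unitaryUnits (Matrix n n ℂ) := (unitaryUnits (Matrix n n ℂ)).mul_mem ((unitaryUnits (Matrix n n ℂ)).mul_mem (hT _ _)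
    (prodOver_mem fun i _ => huF' i)) ((unitaryUnits (Matrix n n ℂ)).inv_mem (hT _ _))
  have huAt₂ : At₂ ∈ unitaryUnits (Matrix n n ℂ) := (unitaryUnits (Matrix n n ℂ)).mul_mem ((unitaryUnits (Matrix n n ℂ)).mul_mem (hT _ _)
    (prodOver_mem fun i _ => huF' i)) ((unitaryUnits (Matrix n n ℂ)).inv_mem (hT _ _))
  have hugk : ∀ k : ℕ, g ^ k ∈ unitaryUnits (Matrix n n ℂ) := fun k => (unitaryUnits (Matrix n n ℂ)).pow_mem hgu k
  -- sizes
  set θ : ℝ := d * ((L - 1 : ℕ) * a₀) with hθdef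
  set θL : ℝ := d * (((L - 1 : ℕ) * L) * a₀) with hθLdef
  have hθ0 : 0 ≤ θ := by positivity
  have hθL0 : 0 ≤ θL := by positivity
  have hθA : ‖(A : Matrix n n ℂ) - 1‖ ≤ θ := norm_hiProd_sub_one_le hh ha ha0 z hq μ
  have hθB : ‖(B : Matrix n n ℂ) - 1‖ ≤ θ := norm_hiProd_sub_one_le hh ha ha0 z hq ν
  have hθΛ' : ‖(Λ' : Matrix n n ℂ) - 1‖ ≤ θL := norm_loProd_sub_one_le hh ha ha0 z (inBox_add_e hq hμ) ν
  have hfac : ∀ i, μ < i → ‖(F i : Matrix n n ℂ) - 1‖ ≤ (L - 1 : ℕ) * a₀ := fun i hi => by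
    rw [hFdef]; dsimp only
    rw [norm_val_inv_sub_one ((unitaryUnits (Matrix n n ℂ)).pow_mem (hh _ _ _) _)]
    refine (norm_val_pow_sub_one_le (hh _ _ _) _).trans ?_
    exact mul_le_mul (by exact_mod_cast toNat_le_of_inBox hq i) (ha _ _ _ hi) (norm_nonneg _) (by positivity)
  have hθA₁ : ‖(A₁ : Matrix n n ℂ) - 1‖ ≤ l₁.length * ((L - 1 : ℕ) * a₀) :=
    norm_val_prodOver_sub_one_le (fun i _ => huF i) fun i hi => hfac i (hl₁₂ i (List.mem_append_left _ hi))
  have hgfac : ∀ i, i < ν → ‖(Gf i : Matrix n n ℂ) - 1‖ ≤ ((L - 1 : ℕ) * L) * a₀ := fun i hi => by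
    rw [hGfdef]; dsimp only
    refine (norm_val_pow_sub_one_le (hh _ _ _) _).trans ?_
    push_cast
    exact mul_le_mul (by exact_mod_cast Nat.mul_le_mul_right L (toNat_le_of_inBox hq i)) (ha _ _ _ hi)
      (norm_nonneg _) (by positivity)
  have hθΛa : ‖(Λa : Matrix n n ℂ) - 1‖ ≤ m₁.length * (((L - 1 : ℕ) * L) * a₀) :=
    norm_val_prodOver_sub_one_le (fun i _ => huGf i) fun i hi => hgfac i (hm₁₂ i (List.mem_append_left _ hi))
  have hθΛb : ‖(Λb : Matrix n n ℂ) - 1‖ ≤ m₂.length * (((L - 1 : ℕ) * L) * a₀) :=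
    norm_val_prodOver_sub_one_le (fun i _ => huGf i) fun i hi => hgfac i (hm₁₂ i (List.mem_append_right _ hi))
  have hl₁d : (l₁.length : ℝ) ≤ d := by have := length_above_le μ; exact_mod_cast (by omega : l₁.length ≤ d)
  have hm₁d : (m₁.length : ℝ) ≤ d := by have := length_below_le ν; exact_mod_cast (by omega : m₁.length ≤ d)
  have hm₂d : (m₂.length : ℝ) ≤ d := by have := length_below_le ν; exact_mod_cast (by omega : m₂.length ≤ d)
  have hθA₁' : ‖(A₁ : Matrix n n ℂ) - 1‖ ≤ θ := hθA₁.trans (by rw [hθdef]; exact mul_le_mul_of_nonneg_right hl₁d (by positivity))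
  have hθΛa' : ‖(Λa : Matrix n n ℂ) - 1‖ ≤ θL :=
    hθΛa.trans (by rw [hθLdef]; exact mul_le_mul_of_nonneg_right hm₁d (by positivity))
  have hθΛb' : ‖(Λb : Matrix n n ℂ) - 1‖ ≤ θL :=
    hθΛb.trans (by rw [hθLdef]; exact mul_le_mul_of_nonneg_right hm₂d (by positivity))
  have hga : ‖(g : Matrix n n ℂ) - 1‖ ≤ a₀ := ha _ _ _ hμν
  have hgL1 : ‖((g ^ L : (Matrix n n ℂ)ˣ) : Matrix n n ℂ) - 1‖ ≤ L * a₀ :=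
    (norm_val_pow_sub_one_le hgu L).trans (mul_le_mul_of_nonneg_left hga (by positivity))
  have hgkL : ‖((g ^ ((q μ).toNat * L) : (Matrix n n ℂ)ˣ) : Matrix n n ℂ) - 1‖ ≤ θL := by
    refine (norm_val_pow_sub_one_le hgu _).trans ?_
    have hk : ((q μ).toNat * L : ℕ) ≤ (L - 1) * L := Nat.mul_le_mul_right L (toNat_le_of_inBox hq μ)
    have hd1 : (1 : ℝ) ≤ d := by
      have : 1 ≤ d := by have := ν.isLt; omega
      exact_mod_cast this
    calc (((q μ).toNat * L : ℕ) : ℝ) * ‖(g : Matrix n n ℂ) - 1‖ ≤ (((L - 1) * L : ℕ) : ℝ) * a₀ :=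
          mul_le_mul (by exact_mod_cast hk) hga (norm_nonneg _) (by positivity)
      _ ≤ θL := by
          rw [hθLdef]; push_cast
          have h0 : (0 : ℝ) ≤ ((L - 1 : ℕ) : ℝ) * L * a₀ := by positivity
          have h1 := mul_le_mul_of_nonneg_right hd1 h0
          linarith [h1]
  -- the transported pieces are `δ`-close (verbatim from F3b)
  have hδ₁ : ‖(At₁ : Matrix n n ℂ) - (A₁ : Matrix n n ℂ)‖ ≤ l₁.length * ((L - 1 : ℕ) * δ) := by
    rw [hAt₁def, hA₁def, prodOver_congr (fun i hi => hF'off i (fun he => hν₁ (he ▸ hi)))]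
    exact norm_conj_prodOver_powInv_sub_le (k := fun i => (q i).toNat) (fun i => hh z μ i)
      (fun i => hh (z + e ν) μ i) (hT _ _) (fun i hi => hδ μ i (hl₁₂ i (List.mem_append_left _ hi)))
      (fun i _ => toNat_le_of_inBox hq i)
  have hδ₂ : ‖(At₂ : Matrix n n ℂ) - (A₂ : Matrix n n ℂ)‖ ≤ l₂.length * ((L - 1 : ℕ) * δ) := by
    rw [hAt₂def, hA₂def, prodOver_congr (fun i hi => hF'off i (fun he => hν₂ (he ▸ hi)))]
    exact norm_conj_prodOver_powInv_sub_le (k := fun i => (q i).toNat) (fun i => hh z μ i)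
      (fun i => hh (z + e ν) μ i) (hT _ _) (fun i hi => hδ μ i (hl₁₂ i (List.mem_append_right _ hi)))
      (fun i _ => toNat_le_of_inBox hq i)
  have hδ₁₂ : ‖((At₁ * At₂ : (Matrix n n ℂ)ˣ) : Matrix n n ℂ) - ((A₁ * A₂ : (Matrix n n ℂ)ˣ) : Matrix n n ℂ)‖ ≤ d * ((L - 1 : ℕ) * δ) := by
    rw [Units.val_mul, Units.val_mul]
    refine (norm_mul_sub_mul_le_of_norm_le_one (norm_val_of_unitary huAt₂).le (norm_val_of_unitary huA₁).le).trans ?_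
    refine (add_le_add hδ₁ hδ₂).trans ?_
    rw [← add_mul]
    refine mul_le_mul_of_nonneg_right ?_ (by positivity)
    have := length_above_le μ
    exact_mod_cast (by omega : l₁.length + l₂.length ≤ d)
  -- THE CHAIN for `‖A·BΛ' − g·BΛ·Ã‖`
  -- step 1: commute `A` past `BΛ'`
  have step1 : ‖((A * (B * Λ') : (Matrix n n ℂ)ˣ) : Matrix n n ℂ) - ((B * Λ' * A : (Matrix n n ℂ)ˣ) : Matrix n n ℂ)‖ ≤ 2 * θ * (θ + θL) := by
    have e1 : (A * (B * Λ') : (Matrix n n ℂ)ˣ) = 1 * (A * (B * Λ')) * 1 := by group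
    have e2 : (B * Λ' * A : (Matrix n n ℂ)ˣ) = 1 * ((B * Λ') * A) * 1 := by group
    rw [e1, e2]
    refine (norm_val_swap_le (unitaryUnits (Matrix n n ℂ)).one_mem (unitaryUnits (Matrix n n ℂ)).one_mem _ _).trans ?_
    have hBΛ' : ‖((B * Λ' : (Matrix n n ℂ)ˣ) : Matrix n n ℂ) - 1‖ ≤ θ + θL := by
      rw [Units.val_mul]
      exact (B8Ineq170.norm_mul_sub_one_le_of_norm_le_one (norm_val_of_unitary (huA _ _ _)).le).trans
        (add_le_add hθB hθΛ')
    exact two_mul_mul_le (mul_le_mul hθA hBΛ' (norm_nonneg _) hθ0)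
  -- rewrite through the splits; common left frame `Fr = B Λa g^{kL}`
  set Fr : (Matrix n n ℂ)ˣ := B * Λa * g ^ ((q μ).toNat * L) with hFrdef
  have huFr : Fr ∈ unitaryUnits (Matrix n n ℂ) :=
    (unitaryUnits (Matrix n n ℂ)).mul_mem ((unitaryUnits (Matrix n n ℂ)).mul_mem (huA _ _ _) huΛa) (hugk _)
  have hθFr : ‖(Fr : Matrix n n ℂ) - 1‖ ≤ θ + θL + θL := by
    rw [hFrdef, Units.val_mul, Units.val_mul]
    refine (B8Ineq170.norm_mul_sub_one_le_of_norm_le_one ?_).trans (add_le_add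
      ((B8Ineq170.norm_mul_sub_one_le_of_norm_le_one (norm_val_of_unitary (huA _ _ _)).le).trans (add_le_add hθB hθΛa')) hgkL)
    rw [← Units.val_mul]; exact (norm_val_of_unitary ((unitaryUnits (Matrix n n ℂ)).mul_mem (huA _ _ _) huΛa)).le
  have eX : (B * Λ' * A : (Matrix n n ℂ)ˣ) = Fr * (g ^ L * (Λb * A₁) * ((g ^ (q ν).toNat)⁻¹ * A₂)) := by
    rw [hΛ', hA, hpow, hFrdef]; group
  have eY : (g * (B * Λ * (t * As * t⁻¹)) : (Matrix n n ℂ)ˣ) = g * Fr * (Λb * At₁ * At₂) := by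
    rw [hΛ, hAt, hFrdef]; group
  -- step 2: inside the frame, commute `g^L` past `Λb A₁` and cancel against `(g^{L-1})⁻¹`
  have step2 : ‖((g ^ L * (Λb * A₁) * ((g ^ (q ν).toNat)⁻¹ * A₂) : (Matrix n n ℂ)ˣ) : Matrix n n ℂ)
      - (((Λb * A₁) * g ^ L * ((g ^ (q ν).toNat)⁻¹ * A₂) : (Matrix n n ℂ)ˣ) : Matrix n n ℂ)‖ ≤ 2 * (L * a₀) * (θL + θ) := by
    have e1 : (g ^ L * (Λb * A₁) * ((g ^ (q ν).toNat)⁻¹ * A₂) : (Matrix n n ℂ)ˣ)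
        = 1 * (g ^ L * (Λb * A₁)) * ((g ^ (q ν).toNat)⁻¹ * A₂) := by group
    have e2 : ((Λb * A₁) * g ^ L * ((g ^ (q ν).toNat)⁻¹ * A₂) : (Matrix n n ℂ)ˣ)
        = 1 * ((Λb * A₁) * g ^ L) * ((g ^ (q ν).toNat)⁻¹ * A₂) := by group
    rw [e1, e2]
    refine (norm_val_swap_le (unitaryUnits (Matrix n n ℂ)).one_mem ((unitaryUnits (Matrix n n ℂ)).mul_mem
      ((unitaryUnits (Matrix n n ℂ)).inv_mem (hugk _)) huA₂) _ _).trans ?_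
    have hΛbA₁ : ‖((Λb * A₁ : (Matrix n n ℂ)ˣ) : Matrix n n ℂ) - 1‖ ≤ θL + θ := by
      rw [Units.val_mul]
      exact (B8Ineq170.norm_mul_sub_one_le_of_norm_le_one (norm_val_of_unitary huΛb).le).trans (add_le_add hθΛb' hθA₁')
    exact two_mul_mul_le (mul_le_mul hgL1 hΛbA₁ (norm_nonneg _) (by positivity))
  have eZ : ((Λb * A₁) * g ^ L * ((g ^ (q ν).toNat)⁻¹ * A₂) : (Matrix n n ℂ)ˣ) = Λb * A₁ * g * A₂ := by
    rw [show (Λb * A₁) * g ^ L * ((g ^ (q ν).toNat)⁻¹ * A₂) = Λb * A₁ * (g ^ L * (g ^ (q ν).toNat)⁻¹) * A₂ by group, hgL]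
  -- step 3: on the `g·Y` side, move `g` past the frame `Fr` and replace the transported rows
  have step3 : ‖((g * Fr * (Λb * At₁ * At₂) : (Matrix n n ℂ)ˣ) : Matrix n n ℂ) - ((Fr * g * (Λb * A₁ * A₂) : (Matrix n n ℂ)ˣ) : Matrix n n ℂ)‖
      ≤ 2 * a₀ * (θ + θL + θL) + d * ((L - 1 : ℕ) * δ) := by
    calc ‖((g * Fr * (Λb * At₁ * At₂) : (Matrix n n ℂ)ˣ) : Matrix n n ℂ) - ((Fr * g * (Λb * A₁ * A₂) : (Matrix n n ℂ)ˣ) : Matrix n n ℂ)‖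
        ≤ ‖((g * Fr * (Λb * At₁ * At₂) : (Matrix n n ℂ)ˣ) : Matrix n n ℂ) - ((Fr * g * (Λb * At₁ * At₂) : (Matrix n n ℂ)ˣ) : Matrix n n ℂ)‖
          + ‖((Fr * g * (Λb * At₁ * At₂) : (Matrix n n ℂ)ˣ) : Matrix n n ℂ) - ((Fr * g * (Λb * A₁ * A₂) : (Matrix n n ℂ)ˣ) : Matrix n n ℂ)‖ :=
          norm_sub_le_norm_sub_add_norm_sub _ _ _
      _ ≤ 2 * a₀ * (θ + θL + θL) + d * ((L - 1 : ℕ) * δ) := by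
          refine add_le_add ?_ ?_
          · have e1 : (g * Fr * (Λb * At₁ * At₂) : (Matrix n n ℂ)ˣ) = 1 * (g * Fr) * (Λb * At₁ * At₂) := by group
            have e2 : (Fr * g * (Λb * At₁ * At₂) : (Matrix n n ℂ)ˣ) = 1 * (Fr * g) * (Λb * At₁ * At₂) := by group
            rw [e1, e2]
            refine (norm_val_swap_le (unitaryUnits (Matrix n n ℂ)).one_mem ((unitaryUnits (Matrix n n ℂ)).mul_mem
              ((unitaryUnits (Matrix n n ℂ)).mul_mem huΛb huAt₁) huAt₂) _ _).trans ?_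
            exact two_mul_mul_le (mul_le_mul hga hθFr (norm_nonneg _) ha0)
          · rw [show (Fr * g * (Λb * At₁ * At₂) : (Matrix n n ℂ)ˣ) = (Fr * g * Λb) * (At₁ * At₂) by group,
              show (Fr * g * (Λb * A₁ * A₂) : (Matrix n n ℂ)ˣ) = (Fr * g * Λb) * (A₁ * A₂) by group,
              norm_val_mul_left_sub ((unitaryUnits (Matrix n n ℂ)).mul_mem ((unitaryUnits (Matrix n n ℂ)).mul_mem huFr hgu) huΛb)]
            exact hδ₁₂
  -- step 4: `Fr·(Λb A₁ g A₂)` against `Fr·g·(Λb A₁ A₂)`: one commutator of `g` with `Λb A₁`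
  have step4 : ‖((Fr * (Λb * A₁ * g * A₂) : (Matrix n n ℂ)ˣ) : Matrix n n ℂ) - ((Fr * g * (Λb * A₁ * A₂) : (Matrix n n ℂ)ˣ) : Matrix n n ℂ)‖
      ≤ 2 * (θL + θ) * a₀ := by
    rw [show (Fr * (Λb * A₁ * g * A₂) : (Matrix n n ℂ)ˣ) = Fr * ((Λb * A₁) * g) * A₂ by group,
      show (Fr * g * (Λb * A₁ * A₂) : (Matrix n n ℂ)ˣ) = Fr * (g * (Λb * A₁)) * A₂ by group,
      norm_val_frame_sub huFr huA₂, Units.val_mul, Units.val_mul]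
    refine (norm_comm_le _ _).trans ?_
    have hΛbA₁ : ‖((Λb : Matrix n n ℂ)) * (A₁ : Matrix n n ℂ) - 1‖ ≤ θL + θ :=
      (B8Ineq170.norm_mul_sub_one_le_of_norm_le_one (norm_val_of_unitary huΛb).le).trans (add_le_add hθΛb' hθA₁')
    exact two_mul_mul_le (mul_le_mul hΛbA₁ hga (norm_nonneg _) (by positivity))
  -- assemble
  calc ‖((A * (B * Λ') : (Matrix n n ℂ)ˣ) : Matrix n n ℂ) - ((g * (B * Λ * (t * As * t⁻¹)) : (Matrix n n ℂ)ˣ) : Matrix n n ℂ)‖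
      ≤ ‖((A * (B * Λ') : (Matrix n n ℂ)ˣ) : Matrix n n ℂ) - ((B * Λ' * A : (Matrix n n ℂ)ˣ) : Matrix n n ℂ)‖
        + ‖((B * Λ' * A : (Matrix n n ℂ)ˣ) : Matrix n n ℂ) - ((g * (B * Λ * (t * As * t⁻¹)) : (Matrix n n ℂ)ˣ) : Matrix n n ℂ)‖ :=
        norm_sub_le_norm_sub_add_norm_sub _ _ _
    _ ≤ 2 * θ * (θ + θL) + (2 * (L * a₀) * (θL + θ) + (2 * (θL + θ) * a₀ + (2 * a₀ * (θ + θL + θL) + d * ((L - 1 : ℕ) * δ)))) := by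
        refine add_le_add step1 ?_
        rw [eX, eY]
        calc ‖((Fr * (g ^ L * (Λb * A₁) * ((g ^ (q ν).toNat)⁻¹ * A₂)) : (Matrix n n ℂ)ˣ) : Matrix n n ℂ)
              - ((g * Fr * (Λb * At₁ * At₂) : (Matrix n n ℂ)ˣ) : Matrix n n ℂ)‖
            ≤ ‖((Fr * (g ^ L * (Λb * A₁) * ((g ^ (q ν).toNat)⁻¹ * A₂)) : (Matrix n n ℂ)ˣ) : Matrix n n ℂ)
                - ((Fr * ((Λb * A₁) * g ^ L * ((g ^ (q ν).toNat)⁻¹ * A₂)) : (Matrix n n ℂ)ˣ) : Matrix n n ℂ)‖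
              + ‖((Fr * ((Λb * A₁) * g ^ L * ((g ^ (q ν).toNat)⁻¹ * A₂)) : (Matrix n n ℂ)ˣ) : Matrix n n ℂ)
                - ((g * Fr * (Λb * At₁ * At₂) : (Matrix n n ℂ)ˣ) : Matrix n n ℂ)‖ := norm_sub_le_norm_sub_add_norm_sub _ _ _
          _ ≤ 2 * (L * a₀) * (θL + θ) + (2 * (θL + θ) * a₀ + (2 * a₀ * (θ + θL + θL) + d * ((L - 1 : ℕ) * δ))) := by
              refine add_le_add ?_ ?_
              · rw [norm_val_mul_left_sub huFr]; exact step2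
              · rw [eZ]
                exact (norm_sub_le_norm_sub_add_norm_sub _ _ _).trans (add_le_add step4 (by rw [norm_sub_rev]; exact step3))
    _ = _ := by rw [hθdef, hθLdef]; ring

end CaseIII

end

end Summit.QuantumFields.BalabanUV.T4Continuum.SkeletonFillFullRootFar
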